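/-
Copyright (c) 2026 the pub-hodgecm-mathlib formalisation cell (harness21).  Prover seat hodgecm-mathlib-K2Liu-p13 (g0), Track B «K2-LIT»,
#184♮ = hLiu418 = `stmt-HodgeConjecture-24832`; Road I v3 organ U1-CT-ind STAGE 2 (Q2), file F4-1 (LEAD F0P6-plan (g13) 09:57:20Z «GO (Q2) F4 → F5 → D-U1 stage 3»).
-/
import Summits.HodgeConjecture.HodgeConjecture.Theorems.K2LiuDoubledAntidiagonalTransportLevi   -- ★∕📤 F3′: `apply_transport_mul`, `detDelta_transport_of_blockTriangular`
import Summits.HodgeConjecture.HodgeConjecture.Theorems.K2LiuKlingenUnipotentDefs               -- ★ F4-0: `klingenUnip`, `nKlingen_*`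
import Summits.HodgeConjecture.HodgeConjecture.Theorems.K2LiuSiegelDoubledLeviMatrix           -- ★ `conjAdele_conjAdele'` (the `hσ` of the letters at `𝔸_L`)
import HarnessLib

/-!
# Crux `HLiu418`, Road I v3, organ U1 stage 2 (Q2), file F4-1: THE ADELIC KLINGEN UNIPOTENT `N_Q(𝔸) ≤ H(𝔸)` — B1a's letter group at `R := 𝔸_L`, `σ := c ⊗ 1`
# identified with the tree's `U(J₄)(𝔸_{L⁺})`, pushed through the transport `Ψ`, and SIEGEL SECTIONS ARE LEFT-`N_Q(𝔸)`-INVARIANT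

Cell `hodgecm-mathlib`, crux item hLiu418 = `stmt-HodgeConjecture-24832`; squad K2 ∕ K2Liu; LEAD F0P6-plan (g13), co-dealer K2E5-plan (g7); prover K2Liu-p13 (g0).
DEFINITIONS WITH BODIES + their algebra (review lane `--kind definition`, `--supports stmt-HodgeConjecture-24832 --as helper`); no `instance`, no notation,
no named-fact hypothesis, no `sorry`.  The transport `Ψ : U(J₄)(𝔸_{L⁺}) ≃ₜ* H(𝔸)` and its clauses (T1)(T3)(T4) are PARAMETERS ∕ HYPOTHESES by value (consumers
`obtain` them once from ★ F3 `exists_antidiagonal_transport` at `n = 2`); nothing is chosen.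
* §1 (generic `R, σ`) the matrix of `n_Q(y,z,t)` is BLOCK-UPPER-TRIANGULAR (`nKlingenM_blockTriangular`) with upper-left `e₂`-block `(1 t; 0 1)` of determinant `1`
  (`toBlocks₁₁_reindex_nKlingenM`, `det_toBlocks₁₁_reindex_nKlingenM`).
* §2 (generic `N`) with `c ⊗ 1` an involution of `𝔸_L` (★ `K2LiuSiegelDoubledLeviMatrix.conjAdele_conjAdele'`), B1a's letter group `unitaryGroupOfForm (c ⊗ 1) (J_N over 𝔸_L)` IS the tree's
  `(quasiSplit L⁺ L c N).Adelic` (`adelic_antidiagonal_eq`: ★ `StdForm.over_map`); **`jAdelic N`** := the identity isomorphism (`MulEquiv.subgroupCongr`), with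
  `adelicVal (jAdelic g) = g` (`adelicVal_jAdelic`, `coe_adelicVal_jAdelic`).
* §3 (`n = 2`) **`klingenUnipA Ψ : Subgroup H(𝔸)`** := `Ψ (jAdelic (N_Q(𝔸_L)))` (★ F4-0 `klingenUnip` at `R := 𝔸_L`), `mem_klingenUnipA_iff`, the letters
  `Ψ (jAdelic (n_Q(y,z,t))) ∈ N_Q(𝔸)`, and — from 📤 F3′ `apply_transport_mul` with §1 — **`apply_klingenUnipA_mul`: `f (u h) = f h` for every Siegel section `f` of `I(s,χ)`
  and `u ∈ N_Q(𝔸)`** (the identity cell of the Q-constant term is `vol · f`). [Xiong2013 §4 Prop. 4.1, §7 L. 7.1], [GanTakeda2011SiegelWeil §7.2], [MoeglinWaldspurger1995 II.1.7].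
HONEST LABEL.  Carriers only, count-neutral: `HC_CM` is proved only modulo the 7 printed citations (2 remaining named inputs: hLiu418 = `stmt-HodgeConjecture-24832`,
h413 = `stmt-HodgeConjecture-24833`) until rung 0 closes.
-/

set_option autoImplicit false
set_option linter.dupNamespace false -- the mandated namespace repeats `HodgeConjecture.HodgeConjecture`

noncomputable section

open scoped Matrix
open NumberField IsDedekindDomain

namespace Summit.HodgeConjecture.HodgeConjecture.Cruxes.HLiu418.K2LiuKlingenUnipotentAdelicDefs

open Literature.NumberTheory.Automorphic Literature.NumberTheory.Automorphic.UnitaryGroup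
open Literature.NumberTheory.GelbartRogawski1991 Literature.NumberTheory.GelbartRogawski1991.GRConstruction
open Literature.NumberTheory.GaloisRepresentations
open Literature.NumberTheory.K2Lit.SiegelDoubled
open Summit.HodgeConjecture.HodgeConjecture.Cruxes.HLiu418.K2LiuDoubledUTwoTwoBorelFrame
open Summit.HodgeConjecture.HodgeConjecture.Cruxes.HLiu418.K2LiuKlingenParabolicDefs
open Summit.HodgeConjecture.HodgeConjecture.Cruxes.HLiu418.K2LiuKlingenUnipotentDefs
open Summit.HodgeConjecture.HodgeConjecture.Cruxes.HLiu418.K2LiuDoubledAntidiagonalTransportLevi (apply_transport_mul detDelta_transport_of_blockTriangular)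
open Summit.HodgeConjecture.HodgeConjecture.Cruxes.HLiu418.K2LiuSiegelDoubledLeviMatrix (conjAdele_conjAdele')
open UnitaryDualPair

/-! ## §1 The matrix of `n_Q(y,z,t)`: block-upper-triangular with unipotent upper-left block -/

section Generic

variable {R : Type*} [CommRing R] {σ : R →+* R}

/-- `n_Q(y,z,t)` is upper-triangular, hence block-upper-triangular. [cite: Xiong2013, §7 Lemma 7.1] -/
theorem nKlingenM_blockTriangular (y z t : R) : (nKlingenM R σ y z t).BlockTriangular id := by
  intro i j hij
  fin_cases i <;> fin_cases j <;> first | exact absurd hij (by decide) | simp [nKlingenM]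

/-- the upper-left `e₂`-block of `n_Q(y,z,t)` is `(1 t; 0 1)`. [cite: Xiong2013, §7 Lemma 7.1] -/
theorem toBlocks₁₁_reindex_nKlingenM (y z t : R) :
    (Matrix.reindex (e₂ (n := 2)).symm (e₂ (n := 2)).symm (nKlingenM R σ y z t)).toBlocks₁₁ = !![1, t; 0, 1] := by
  ext i j
  fin_cases i <;> fin_cases j <;> rfl

/-- … of determinant `1` (block-UNIPOTENT). [cite: Xiong2013, §7 Lemma 7.1] -/
theorem det_toBlocks₁₁_reindex_nKlingenM (y z t : R) :
    ((Matrix.reindex (e₂ (n := 2)).symm (e₂ (n := 2)).symm (nKlingenM R σ y z t)).toBlocks₁₁).det = 1 := by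
  rw [toBlocks₁₁_reindex_nKlingenM, Matrix.det_fin_two_of]
  ring

end Generic

/-! ## §2 B1a's letter group at `R := 𝔸_L`, `σ := c ⊗ 1` IS the tree's `U(J_N)(𝔸_{L⁺})` -/

variable (L : Type) [Field L] [NumberField L] [IsCMField L]

/-- **the two readings of `U(J_N)(𝔸_{L⁺})` coincide**: the tree's `UnitaryGroup.adelic L⁺ L c N (J_N ⊗ L)` is B1a's `unitaryGroupOfForm (c ⊗ 1) (J_N over 𝔸_L)`
(`adelicForm (J_N over L) = J_N over 𝔸_L`, ★ `StdForm.over_map`). [cite: Mok2014, §1 Notation p. 5] -/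
theorem adelic_antidiagonal_eq (N : ℕ) :
    UnitaryGroup.adelic (Fp L) L (IsCMField.complexConj L) N ((StdForm.antidiagonal N).over L) =
      unitaryGroupOfForm (conjAdele (Fp L) L (IsCMField.complexConj L)) ((StdForm.antidiagonal N).over (AdeleRing (𝓞 L) L)) := by
  rw [UnitaryGroup.adelic, UnitaryGroup.adelicForm, StdForm.over_map]

/-- **`jAdelic N : U(J_N)(𝔸_L, c ⊗ 1) ≃* (quasiSplit L⁺ L c N).Adelic`** — the identity on matrices (B1a's letters read in the tree's adelic group).
[cite: Mok2014, §1 Notation p. 5] -/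
def jAdelic (N : ℕ) :
    unitaryGroupOfForm (conjAdele (Fp L) L (IsCMField.complexConj L)) ((StdForm.antidiagonal N).over (AdeleRing (𝓞 L) L)) ≃*
      (quasiSplit (Fp L) L (IsCMField.complexConj L) N).Adelic :=
  MulEquiv.subgroupCongr (adelic_antidiagonal_eq L N).symm

/-- `jAdelic` is the identity on the underlying invertible matrices: `adelicVal (jAdelic g) = g`. [cite: Mok2014, §1 Notation p. 5] -/
theorem adelicVal_jAdelic (N : ℕ) (g : unitaryGroupOfForm (conjAdele (Fp L) L (IsCMField.complexConj L)) ((StdForm.antidiagonal N).over (AdeleRing (𝓞 L) L))) :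
    adelicVal (Fp L) L (IsCMField.complexConj L) N _ (jAdelic L N g) = (g : GL (Fin N) (AdeleRing (𝓞 L) L)) := by
  rw [adelicVal_apply]
  exact MulEquiv.subgroupCongr_apply _ _

/-- `adelicVal (jAdelic g) = g` on matrices. [cite: Mok2014, §1 Notation p. 5] -/
theorem coe_adelicVal_jAdelic (N : ℕ) (g : unitaryGroupOfForm (conjAdele (Fp L) L (IsCMField.complexConj L)) ((StdForm.antidiagonal N).over (AdeleRing (𝓞 L) L))) :
    ((adelicVal (Fp L) L (IsCMField.complexConj L) N _ (jAdelic L N g) : GL (Fin N) (AdeleRing (𝓞 L) L)) : Matrix (Fin N) (Fin N) (AdeleRing (𝓞 L) L)) =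
      ((g : GL (Fin N) (AdeleRing (𝓞 L) L)) : Matrix (Fin N) (Fin N) (AdeleRing (𝓞 L) L)) := by
  rw [adelicVal_jAdelic]

/-- the matrix of the adelic letter `jAdelic (n_Q(y,z,t))` is `nKlingenM`. [cite: Xiong2013, §7 Lemma 7.1] -/
theorem coe_adelicVal_jAdelic_nKlingen (y : AdeleRing (𝓞 L) L) (hy : conjAdele (Fp L) L (IsCMField.complexConj L) y = -y) (z t : AdeleRing (𝓞 L) L) :
    ((adelicVal (Fp L) L (IsCMField.complexConj L) 4 _
        (jAdelic L 4 (nKlingen (AdeleRing (𝓞 L) L) (conjAdele (Fp L) L (IsCMField.complexConj L)) (conjAdele_conjAdele' L) y hy z t)) :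
          GL (Fin 4) (AdeleRing (𝓞 L) L)) : Matrix (Fin 4) (Fin 4) (AdeleRing (𝓞 L) L)) =
      nKlingenM (AdeleRing (𝓞 L) L) (conjAdele (Fp L) L (IsCMField.complexConj L)) y z t := by
  rw [coe_adelicVal_jAdelic, coe_nKlingen]

/-! ## §3 `N_Q(𝔸) ≤ H(𝔸)` through the transport `Ψ` (`n = 2`) and the left-invariance of Siegel sections -/

variable {L}
variable {N M : ℕ} {e : Fin N × Fin M ≃ Fin 2}
  {dV : Fin N → L} {hdV : ∀ i, IsCMField.complexConj L (dV i) = dV i}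
  {dW : Fin M → L} {hdW : ∀ i, IsCMField.complexConj L (dW i) = dW i}

/-- **`N_Q(𝔸) ≤ H(𝔸)`**: the image under the transport `Ψ` of the Heisenberg unipotent `N_Q(𝔸_L) = {n_Q(y,z,t)}` of the Klingen parabolic of `U(J₄)`.
[cite: Xiong2013, §7 Lemma 7.1] [cite: GanTakeda2011SiegelWeil, §7.2 p. 23] [cite: MoeglinWaldspurger1995, I.2.1] -/
def klingenUnipA (Ψ : (quasiSplit (Fp L) L (IsCMField.complexConj L) (2 + 2)).Adelic ≃ₜ* HA L e dV hdV dW hdW) : Subgroup (HA L e dV hdV dW hdW) :=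
  ((klingenUnip (AdeleRing (𝓞 L) L) (conjAdele (Fp L) L (IsCMField.complexConj L)) (conjAdele_conjAdele' L)).map
      (jAdelic L 4).toMonoidHom).map Ψ.toMulEquiv.toMonoidHom

/-- membership in `N_Q(𝔸)`: `u = Ψ (jAdelic (n_Q(y,z,t)))`. [cite: Xiong2013, §7 Lemma 7.1] -/
theorem mem_klingenUnipA_iff (Ψ : (quasiSplit (Fp L) L (IsCMField.complexConj L) (2 + 2)).Adelic ≃ₜ* HA L e dV hdV dW hdW) (u : HA L e dV hdV dW hdW) :
    u ∈ klingenUnipA Ψ ↔ ∃ (y : AdeleRing (𝓞 L) L) (hy : conjAdele (Fp L) L (IsCMField.complexConj L) y = -y) (z t : AdeleRing (𝓞 L) L),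
      u = Ψ (jAdelic L 4 (nKlingen (AdeleRing (𝓞 L) L) (conjAdele (Fp L) L (IsCMField.complexConj L)) (conjAdele_conjAdele' L) y hy z t)) := by
  constructor
  · rintro ⟨g', ⟨g, ⟨y, hy, z, t, rfl⟩, rfl⟩, rfl⟩
    exact ⟨y, hy, z, t, rfl⟩
  · rintro ⟨y, hy, z, t, rfl⟩
    exact ⟨_, ⟨_, nKlingen_mem_klingenUnip (conjAdele_conjAdele' L) y hy z t, rfl⟩, rfl⟩

/-- the transported letters lie in `N_Q(𝔸)`. [cite: Xiong2013, §7 Lemma 7.1] -/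
theorem transport_nKlingen_mem (Ψ : (quasiSplit (Fp L) L (IsCMField.complexConj L) (2 + 2)).Adelic ≃ₜ* HA L e dV hdV dW hdW)
    (y : AdeleRing (𝓞 L) L) (hy : conjAdele (Fp L) L (IsCMField.complexConj L) y = -y) (z t : AdeleRing (𝓞 L) L) :
    Ψ (jAdelic L 4 (nKlingen (AdeleRing (𝓞 L) L) (conjAdele (Fp L) L (IsCMField.complexConj L)) (conjAdele_conjAdele' L) y hy z t)) ∈ klingenUnipA Ψ :=
  (mem_klingenUnipA_iff Ψ _).2 ⟨y, hy, z, t, rfl⟩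

/-- **SIEGEL SECTIONS ARE LEFT-`N_Q(𝔸)`-INVARIANT**: under the clauses (T1) `↑(Ψ g) = SA·g·SA⁻¹`, (T3) (`SA = (1 X; 1 −X)`, `SA⁻¹ = (a a; Y −Y)`, `a + a = 1`) and
(T4) (block-upper-triangular ↦ `P_Δ(𝔸)`) of ★ F3, `f (u h) = f h` for every Siegel section `f` of `I(s, χ)` and every `u ∈ N_Q(𝔸)` — `n_Q(y,z,t)` is block-unipotent,
so `det_Δ(Ψ n_Q) = 1` (📤 F3′). [cite: Xiong2013, §4 Prop. 4.1] [cite: MoeglinWaldspurger1995, II.1.7] -/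
theorem apply_klingenUnipA_mul {SA : GL (Fin (2 + 2)) (AdeleRing (𝓞 L) L)}
    {Ψ : (quasiSplit (Fp L) L (IsCMField.complexConj L) (2 + 2)).Adelic ≃ₜ* HA L e dV hdV dW hdW} {X Y : Matrix (Fin 2) (Fin 2) (Fp L)} {a : Fp L}
    (hΨ : ∀ g : (quasiSplit (Fp L) L (IsCMField.complexConj L) (2 + 2)).Adelic,
      (((Ψ g : HA L e dV hdV dW hdW) : GL (Fin (2 + 2)) (AdeleRing (𝓞 L) L)) : Matrix (Fin (2 + 2)) (Fin (2 + 2)) (AdeleRing (𝓞 L) L)) =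
        (SA : Matrix (Fin (2 + 2)) (Fin (2 + 2)) (AdeleRing (𝓞 L) L)) *
          ((adelicVal (Fp L) L (IsCMField.complexConj L) (2 + 2) _ g : GL (Fin (2 + 2)) (AdeleRing (𝓞 L) L)) :
            Matrix (Fin (2 + 2)) (Fin (2 + 2)) (AdeleRing (𝓞 L) L)) *
          ((SA⁻¹ : GL (Fin (2 + 2)) (AdeleRing (𝓞 L) L)) : Matrix (Fin (2 + 2)) (Fin (2 + 2)) (AdeleRing (𝓞 L) L)))
    (ha : a + a = 1)
    (hSA : Matrix.reindex (e₂ (n := 2)).symm (e₂ (n := 2)).symm (SA : Matrix (Fin (2 + 2)) (Fin (2 + 2)) (AdeleRing (𝓞 L) L)) =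
      Matrix.fromBlocks (1 : Matrix (Fin 2) (Fin 2) (AdeleRing (𝓞 L) L)) (X.map ((algebraMap L (AdeleRing (𝓞 L) L)).comp (algebraMap (Fp L) L))) 1
        (-(X.map ((algebraMap L (AdeleRing (𝓞 L) L)).comp (algebraMap (Fp L) L)))))
    (hSAi : Matrix.reindex (e₂ (n := 2)).symm (e₂ (n := 2)).symm ((SA⁻¹ : GL (Fin (2 + 2)) (AdeleRing (𝓞 L) L)) : Matrix (Fin (2 + 2)) (Fin (2 + 2)) (AdeleRing (𝓞 L) L)) =
      Matrix.fromBlocks ((a • (1 : Matrix (Fin 2) (Fin 2) (Fp L))).map ((algebraMap L (AdeleRing (𝓞 L) L)).comp (algebraMap (Fp L) L)))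
        ((a • (1 : Matrix (Fin 2) (Fin 2) (Fp L))).map ((algebraMap L (AdeleRing (𝓞 L) L)).comp (algebraMap (Fp L) L)))
        (Y.map ((algebraMap L (AdeleRing (𝓞 L) L)).comp (algebraMap (Fp L) L)))
        (-(Y.map ((algebraMap L (AdeleRing (𝓞 L) L)).comp (algebraMap (Fp L) L)))))
    (hΨP : ∀ b : (quasiSplit (Fp L) L (IsCMField.complexConj L) (2 + 2)).Adelic,
      ((adelicVal (Fp L) L (IsCMField.complexConj L) (2 + 2) _ b : GL (Fin (2 + 2)) (AdeleRing (𝓞 L) L)) :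
          Matrix (Fin (2 + 2)) (Fin (2 + 2)) (AdeleRing (𝓞 L) L)).BlockTriangular id →
        IsSiegelDelta L e dV hdV dW hdW (Ψ b))
    {χ : HeckeCharacter L} {s : ℂ} {f : HA L e dV hdV dW hdW → ℂ} (hf : IsSiegelDeltaSection L e dV hdV dW hdW χ s f)
    {u : HA L e dV hdV dW hdW} (hu : u ∈ klingenUnipA Ψ) (h : HA L e dV hdV dW hdW) :
    f (u * h) = f h := by
  obtain ⟨y, hy, z, t, rfl⟩ := (mem_klingenUnipA_iff Ψ u).1 hu
  have hmat := coe_adelicVal_jAdelic_nKlingen L y hy z t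
  exact apply_transport_mul hΨ ha hSA hSAi hΨP hf (by rw [hmat]; exact nKlingenM_blockTriangular y z t)
    (by rw [hmat]; exact det_toBlocks₁₁_reindex_nKlingenM y z t) h

end Summit.HodgeConjecture.HodgeConjecture.Cruxes.HLiu418.K2LiuKlingenUnipotentAdelicDefs

end
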